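import Mathlib.Analysis.Matrix.Spectrum
import Mathlib.LinearAlgebra.Matrix.BilinearForm
import Mathlib.LinearAlgebra.Basis.SMul
import Literature.Geometry.Lorentzian.MetricNormSq
import HarnessLib

/-!
# The determinant of `g⁻¹ g'` for uniformly equivalent Riemannian metrics:
# `(1 − ε)^d ≤ det (♯_g ∘ ♭_{g'}) ≤ (1 + ε)^d`

For two Riemannian metrics `g, g'` on the same vector bundle with
`(1 − ε) g(v,v) ≤ g'(v,v) ≤ (1 + ε) g(v,v)` on a fibre (`0 ≤ ε ≤ 1`), the endomorphism
`T = ♯_g ∘ ♭_{g'}` of that fibre (`g(Tv, w) = g'(v, w)`), whose determinant is the square of the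
ratio `dV_{g'}/dV_g` of the volume densities (`RiemannianMeasureComparison.lean`), satisfies
`(1 − ε)^d ≤ det T ≤ (1 + ε)^d`, `d` the fibre dimension
(`PseudoRiemannianMetric.det_sharp_comp_toBilinForm_mem_Icc`). In a `g`-orthonormal basis of
the fibre (`exists_orthonormal_basis`, normalising Mathlib's orthogonal basis), `det T` is the
determinant of the (symmetric) Gram matrix `A = (g'(eᵢ, eⱼ))` (`LinearMap.BilinForm.toMatrix_compLeft`),
whose eigenvalues are Rayleigh quotients `g'(w,w)/g(w,w) ∈ [1 − ε, 1 + ε]`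
(`Matrix.IsHermitian.eigenvalues_eq`), and `det A` is their product
(`Matrix.IsHermitian.det_eq_prod_eigenvalues`).

This is the pointwise linear algebra behind the volume comparison of the metrics
`ds²_t = ds² + t Ric` of Schoen–Yau 1979 (Comm. Math. Phys. 65, pp. 72–74: with
`|Ric(v,v)| ≤ C ds²(v,v)`, `(1 − |t|C)³ ≤ dV_t²/dV² ≤ (1 + |t|C)³`), i.e. of the uniformity in `t`
of the constants in (3.28)–(3.29). All results are proved; no definitions, no named facts.

## References

* R. Schoen, S.-T. Yau, Comm. Math. Phys. 65 (1979) 45–76, (3.28)–(3.29) (p. 73). [SchoenYauPMT1979]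
* I. Chavel, *Riemannian Geometry*, 2nd ed. (2006), §III.3. [Chavel2006]
-/

noncomputable section

open Module Matrix
open scoped ContDiff Manifold

namespace Literature.Geometry.Lorentzian

namespace PseudoRiemannianMetric

variable
  {EB : Type*} [NormedAddCommGroup EB] [NormedSpace ℝ EB]
  {HB : Type*} [TopologicalSpace HB] {IB : ModelWithCorners ℝ EB HB} {n : ℕ∞ω}
  {B : Type*} [TopologicalSpace B] [ChartedSpace HB B]
  {F : Type*} [NormedAddCommGroup F] [NormedSpace ℝ F] [FiniteDimensional ℝ F]
  {E : B → Type*} [TopologicalSpace (Bundle.TotalSpace F E)]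
  [∀ b, TopologicalSpace (E b)] [∀ b, AddCommGroup (E b)] [∀ b, Module ℝ (E b)]
  [FiberBundle F E] [VectorBundle ℝ F E]
  (g : PseudoRiemannianMetric IB n F E) (b : B)

/-- **Every fibre of a Riemannian bundle metric has a `g_b`-orthonormal basis**
(`g(eᵢ, eⱼ) = δᵢⱼ`), obtained by normalising the orthogonal basis of non-null vectors of
`exists_isOrthoᵢ_basis`. O'Neill 1983, Ch. 2, Lemma 2.24. [folklore] -/
theorem exists_orthonormal_basis (hg : g.IsRiemannian) :
    ∃ e : Basis (Fin (finrank ℝ (E b))) ℝ (E b),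
      ∀ i j, g.val b (e i) (e j) = if i = j then 1 else 0 := by
  classical
  obtain ⟨e, he, hne⟩ := g.exists_isOrthoᵢ_basis b
  have hpos : ∀ i, 0 < g.val b (e i) (e i) := fun i ↦ hg b (e i) (e.ne_zero i)
  set c : Fin (finrank ℝ (E b)) → ℝ := fun i ↦ (Real.sqrt (g.val b (e i) (e i)))⁻¹ with hc
  have hc0 : ∀ i, c i ≠ 0 := fun i ↦ inv_ne_zero (Real.sqrt_pos.2 (hpos i)).ne'
  refine ⟨e.unitsSMul fun i ↦ Units.mk0 (c i) (hc0 i), fun i j ↦ ?_⟩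
  simp only [Basis.unitsSMul_apply, Units.smul_def, Units.val_mk0, map_smul, FunLike.coe_smul,
    Pi.smul_apply, smul_eq_mul]
  split_ifs with hij
  · subst hij
    set s : ℝ := Real.sqrt (g.val b (e i) (e i)) with hsdef
    have hs2 : s * s = g.val b (e i) (e i) := Real.mul_self_sqrt (hpos i).le
    have hs0 : s ≠ 0 := (Real.sqrt_pos.2 (hpos i)).ne'
    have hci : c i = s⁻¹ := rfl
    rw [hci, ← hs2]
    field_simp
  · have h0 : g.val b (e i) (e j) = 0 := by
      have := he hij
      simpa using this
    rw [h0, mul_zero, mul_zero]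

/-- `g' = g ∘ (T × id)` on a fibre for `T = ♯_g ∘ ♭_{g'}`. [folklore] -/
theorem toBilinForm_eq_compLeft (g' : PseudoRiemannianMetric IB n F E) :
    g'.toBilinForm b = (g.toBilinForm b).compLeft ((g.sharp b).toLinearMap ∘ₗ g'.toBilinForm b) := by
  refine LinearMap.ext fun v ↦ LinearMap.ext fun w ↦ ?_
  rw [LinearMap.BilinForm.compLeft_apply]
  simp only [LinearMap.coe_comp, LinearEquiv.coe_coe, Function.comp_apply, toBilinForm_apply,
    val_sharp_apply]

/-- **`(1 − ε)^d ≤ det (♯_g ∘ ♭_{g'}) ≤ (1 + ε)^d` for uniformly equivalent Riemannian metrics.**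
If `g` is Riemannian and `(1 − ε) g(v,v) ≤ g'(v,v) ≤ (1 + ε) g(v,v)` on the fibre at `b`
(`ε ≤ 1`), then the endomorphism `T = ♯_g ∘ ♭_{g'}` of the fibre (`g(Tv,w) = g'(v,w)`) has
`(1 − ε)^d ≤ det T ≤ (1 + ε)^d`, `d = dim F`. (In a `g`-orthonormal basis `det T = det A`,
`A = (g'(eᵢ,eⱼ))` symmetric with eigenvalues `g'(w,w)/g(w,w) ∈ [1 − ε, 1 + ε]`.)
[cite: SchoenYauPMT1979, (3.28)–(3.29) (p. 73)] -/
theorem det_sharp_comp_toBilinForm_mem_Icc (hg : g.IsRiemannian) (g' : PseudoRiemannianMetric IB n F E)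
    {ε : ℝ} (hε1 : ε ≤ 1)
    (hlo : ∀ v : E b, (1 - ε) * g.val b v v ≤ g'.val b v v)
    (hhi : ∀ v : E b, g'.val b v v ≤ (1 + ε) * g.val b v v) :
    (1 - ε) ^ finrank ℝ F ≤ LinearMap.det ((g.sharp b).toLinearMap ∘ₗ g'.toBilinForm b) ∧
      LinearMap.det ((g.sharp b).toLinearMap ∘ₗ g'.toBilinForm b) ≤ (1 + ε) ^ finrank ℝ F := by
  classical
  haveI := VectorBundle.finiteDimensional ℝ F E b
  set d : ℕ := finrank ℝ (E b) with hd
  have hdF : finrank ℝ F = d := (VectorBundle.finrank_eq ℝ F E b).symm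
  obtain ⟨e, he⟩ := g.exists_orthonormal_basis b hg
  set T : E b →ₗ[ℝ] E b := (g.sharp b).toLinearMap ∘ₗ g'.toBilinForm b with hT
  -- the Gram matrices in the orthonormal basis: `G = 1`, `A = (g'(eᵢ,eⱼ))`
  set A : Matrix (Fin d) (Fin d) ℝ := LinearMap.BilinForm.toMatrix e (g'.toBilinForm b) with hA
  have hG : LinearMap.BilinForm.toMatrix e (g.toBilinForm b) = 1 := by
    ext i j
    rw [LinearMap.BilinForm.toMatrix_apply, toBilinForm_apply, he i j, Matrix.one_apply]
  -- `det A = det T`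
  have hdet : A.det = LinearMap.det T := by
    rw [hA, toBilinForm_eq_compLeft g b g', LinearMap.BilinForm.toMatrix_compLeft, hG,
      Matrix.mul_one, Matrix.det_transpose, LinearMap.det_toMatrix]
  -- `A` is symmetric
  have hAs : A.IsHermitian := Matrix.IsHermitian.ext fun i j ↦ by
    rw [star_trivial, hA, LinearMap.BilinForm.toMatrix_apply, LinearMap.BilinForm.toMatrix_apply,
      toBilinForm_apply, toBilinForm_apply, g'.symm]
  -- the Rayleigh quotients: `u ⬝ (A u) = g'(w,w)`, `u ⬝ u = g(w,w)` for `w = ∑ uᵢ eᵢ`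
  have hquad : ∀ u : Fin d → ℝ, u ⬝ᵥ (A *ᵥ u) = g'.val b (e.equivFun.symm u) (e.equivFun.symm u) :=
    fun u ↦ by rw [hA, LinearMap.BilinForm.dotProduct_toMatrix_mulVec, toBilinForm_apply]
  have hquad0 : ∀ u : Fin d → ℝ, u ⬝ᵥ u = g.val b (e.equivFun.symm u) (e.equivFun.symm u) := by
    intro u
    have h := LinearMap.BilinForm.dotProduct_toMatrix_mulVec e (g.toBilinForm b) u u
    rw [hG, Matrix.one_mulVec, toBilinForm_apply] at h
    exact h
  -- eigenvalue bounds
  have hev : ∀ i, 1 - ε ≤ hAs.eigenvalues i ∧ hAs.eigenvalues i ≤ 1 + ε := by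
    intro i
    set u : Fin d → ℝ := ⇑(hAs.eigenvectorBasis i) with hu
    have hnorm : ‖hAs.eigenvectorBasis i‖ = 1 := hAs.eigenvectorBasis.orthonormal.1 i
    have huu : u ⬝ᵥ u = 1 := by
      have h2 : ‖hAs.eigenvectorBasis i‖ ^ 2 = u ⬝ᵥ u := by
        rw [EuclideanSpace.norm_eq, Real.sq_sqrt (Finset.sum_nonneg fun j _ ↦ by positivity)]
        simp only [dotProduct, hu, Real.norm_eq_abs, sq, abs_mul_abs_self]
      rw [← h2, hnorm, one_pow]
    have hlam : hAs.eigenvalues i = u ⬝ᵥ (A *ᵥ u) := by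
      rw [hAs.eigenvalues_eq i]
      simp [hu, star_trivial]
    set w : E b := e.equivFun.symm u with hw
    have hgw : g.val b w w = 1 := by rw [hw, ← hquad0, huu]
    rw [hlam, hquad]
    constructor
    · have := hlo w
      rw [hgw, mul_one] at this
      exact this
    · have := hhi w
      rw [hgw, mul_one] at this
      exact this
  -- the determinant is the product of the eigenvalues
  have hprod : LinearMap.det T = ∏ i, hAs.eigenvalues i := by
    rw [← hdet, hAs.det_eq_prod_eigenvalues]
    rfl
  rw [hdF, hprod]
  constructor
  · calc (1 - ε) ^ d = ∏ _i : Fin d, (1 - ε) := by simp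
      _ ≤ ∏ i, hAs.eigenvalues i :=
          Finset.prod_le_prod (fun i _ ↦ by linarith) fun i _ ↦ (hev i).1
  · calc ∏ i, hAs.eigenvalues i ≤ ∏ _i : Fin d, (1 + ε) :=
          Finset.prod_le_prod (fun i _ ↦ by linarith [(hev i).1]) fun i _ ↦ (hev i).2
      _ = (1 + ε) ^ d := by simp

/-- **`det (♯_{g'} ∘ ♭_g) · det (♯_g ∘ ♭_{g'}) = 1`**: the two comparison endomorphisms are
mutually inverse (`♯ ∘ ♭ = id`), so their determinants are reciprocal. [folklore] -/
theorem det_sharp_comp_toBilinForm_mul_swap (g' : PseudoRiemannianMetric IB n F E) :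
    LinearMap.det ((g'.sharp b).toLinearMap ∘ₗ g.toBilinForm b) *
      LinearMap.det ((g.sharp b).toLinearMap ∘ₗ g'.toBilinForm b) = 1 := by
  rw [← LinearMap.det_comp]
  have hid : ((g'.sharp b).toLinearMap ∘ₗ g.toBilinForm b) ∘ₗ
      ((g.sharp b).toLinearMap ∘ₗ g'.toBilinForm b) = LinearMap.id := by
    refine LinearMap.ext fun v ↦ ?_
    simp only [LinearMap.coe_comp, LinearEquiv.coe_coe, Function.comp_apply, LinearMap.id_coe, id_eq]
    have h1 : g.toBilinForm b (g.sharp b (g'.toBilinForm b v)) = g'.toBilinForm b v := by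
      refine LinearMap.ext fun w ↦ ?_
      rw [toBilinForm_apply, val_sharp_apply]
    rw [h1]
    have h2 : g'.toBilinForm b v = g'.flat b v := rfl
    rw [h2, sharp_flat]
  rw [hid, LinearMap.det_id]

end PseudoRiemannianMetric

end Literature.Geometry.Lorentzian

end
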